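import Mathlib
import HarnessLib
import HarnessLib.Audit
import Summits.Schanuel.Statement

/-!
Route: GridCapacity

CLOSED (retired) 2026-08-15T13:51:07Z by operator:999:1257524 — reason: not-a-thesis: assembly does not conclude the sub-problem Statement — note: D-0027 §2.1 audit (human 2026-08-15: routes that do not decide the summit are removed): the assembly concludes `KneserCapacityBound ∧ ExtremalGridsDilate ∧ THFreeFloorOnProgressions`, not the sub-problem statement; a NEW conforming route may be opened from the same idea (generated `closes : … → _roo. The file is kept as the record of this route; refuted decls are indexed as negative knowledge (`ledger negatives`).

# Route GridCapacity — Grid capacity calibrates the Gel'fond–Schneider class: at most (n+h(L))/4 of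
Schanuel on any span (barrier route)

BARRIER / CALIBRATION ROUTE (D-0021 negative knowledge), realising idea card
grid-capacity-half-schanuel. Declared up front: X does NOT imply
Schanuel and is not claimed to; the Assembly concludes in the route's own target. For a ℚ-linearly
independent x ∈ ℂⁿ put L = span_ℚ(x)
and h(L) = the largest degree of a number field H with a line λH ⊆ L (1 ≤ h(L) ≤ n). A GRID inside L
is a pair of ℚ-independent finite
families X (d elements), Y (l elements) with X·Y ⊆ L — exactly the data on which every theorem and
conjecture of the several-variables
Gel'fond–Schneider class speaks about ℚ(x, eˣ) (its output is ≈ dl/(d+l), Diaz / Waldschmidt's Conj.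
2.3). X = X1 ∧ X2 ∧ X3:
X1 (KneserCapacityBound, ceiling): d + l ≤ n + h(L), hence capacity dl/(d+l) ≤ (n+h(L))/4 ≤ n/2 —
half of Schanuel at most, a quarter
on power spans; X2 (ExtremalGridsDilate, inverse side): grids attaining d = l = (n+h)/2 force a
dilation θ ∉ multipliers with
dim(L ∩ θL) ≥ n − 2h (progressions on number-field lines give n − h, linear systems on pointless
conics give n − 2h); X3
(THFreeFloorOnProgressions, floor): on the extremal tuples x = c·ω_i θ^s (ω a ℚ-basis of a number
field of degree h, s ≤ 2a) the class's
printed output ⌈h(a+1)/2⌉ ≤ trdeg ℚ(x, eˣ) holds WITHOUT Diaz's Technical Hypothesis on θ.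
Lean: `KneserCapacityBound ∧ ExtremalGridsDilate ∧ THFreeFloorOnProgressions`

## Assembly
Pure logic: the target is the conjunction of the two cruxes and the Kneser ceiling; `fun h1 h2 h3 =>
⟨h1, h2, h3⟩` (checked in the planner's
Sketch.lean, axioms propext/Classical.choice/Quot.sound). NOT an implication to the summit — a
barrier/calibration route by declaration; its
Theorems files are meant to be vendored as an addendum to
Literature.Barriers.Schanuel.LargeTranscendenceDegree ("conjectural horizon of the
class = (n+h(L))/4 ≤ n/2 on every span") and as the positive sector theorem
HalfSchanuelOnLinesOfDiaz.

Rationale: WHY THIS LINE. The card's invariant (grid capacity g(L) = max dl/(d+l) over grids in L) turns the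
catalogued barrier Literature.Barriers.Schanuel.LargeTranscendenceDegree
("≈ dl/(d+l) under (T.H.)", NesterenkoPhilippon2001 Ch.14 Thm 2.7/2.9, Conj. 2.3; Chudnovsky1984
p.22 "half of Schanuel") into a per-tuple
number, and this planner's addition is that ONE theorem of linear additive combinatorics — Kneser's
theorem for field extensions
(HouLeungXiang2002 Thm; BachocSerraZemor2018Kneser), dim UV ≥ dim U + dim V − [Stab(UV):ℚ] — gives
the whole ceiling at once:
d + l ≤ n + h(L), so g(L) ≤ (n+h(L))/4, which is n/2 exactly on number-field lines (the
Gel'fond–Diaz ladders of route AlgIndepMethod),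
(n+1)/4 on power spans (Chudnovsky's 3 of e,…,e^(e⁷) and 4 of e,…,e^(e¹¹) are ⌈9/4⌉ and ⌈13/4⌉), and
it contains the card's stability
problem C1 as its contrapositive (capacity ≥ (1/2−ε)n ⇒ L contains a number-field line of degree ≥
(1−4ε)n). Imported area: additive
combinatorics of subspaces of a field extension (Kneser/Vosper/Sidon spaces, BachocSerraZemor2017,
Eliahou–Lecouvey), with the exact
dictionary product set X·Y ⊆ span ↔ sumset, multiplier field ↔ period, h(L) ↔ largest coset inside;
genre precedent for a
limit-of-method theorem by ℚ-linear algebra: Roy1995 Thm 3.4 (barrier LinearSubgroupMethodLimit).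
What prior routes do not do:
AlgIndepMethod staffs the g = n/2 case; this route certifies that n/2 is the ceiling of the class
INCLUDING its conjectural completion
(Conj. 2.3 gives ⌊dl/(d+l)⌋+1 ≤ ⌊(n+h)/4⌋+1), classifies where it is attained, files the class's own
open frontier on those tuples
(T.H. removal, crux 2) and lands the positive corollary "⌈n/2⌉ of Schanuel on EVERY number-field
line" for arbitrary λ (support, from
Diaz's printed theorem with T.H. discharged by Liouville). Negatives index: empty at filing.

RANKED CRUXES. #0 GridCapacityCalibration (target) — X = X1 ∧ X2 ∧ X3 as in § Thesis (ceiling ∧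
inverse structure ∧ T.H.-free floor). (why it might fail: X2 bets on an unwritten classification of
critical pairs of ℚ-subspaces of ℂ (open: BachocSerraZemor2017 §1); X3 is T.H. removal beyond output
2, open since Tijdeman 1970.) [NesterenkoPhilippon2001, HouLeungXiang2002, BachocSerraZemor2017,
Chudnovsky1984]
#2 THFreeFloorOnProgressions (crux) — for a ℚ-basis ω of a number field of degree h (span closed
under products), θ, c ≠ 0, a ≥ 1 with h(a+1) ≥ 3 and the h(2a+1) numbers ω_i θ^s (s ≤ 2a) ℚ-linearly
independent, put x = c·ω_i θ^s; then ⌈h(a+1)/2⌉ ≤ trdeg ℚ(x, eˣ). This is Diaz's output on the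
extremal grid X = c·ω⊗θ^(≤a), Y = ω⊗θ^(≤a) (d = l = h(a+1)) with NO Technical Hypothesis on θ (for
the ω-part it is automatic, for c it is free); the case a = 0 is the support item
HalfSchanuelOnLinesOfDiaz. Implied by Schanuel (n = h(2a+1)); known when the output is 2 (Thm 2.9,
T.H.-free) and for θ satisfying (T.H.) (Thm 2.7). [difficulty: open-problem] (why it might fail:
Cannot be false unless Schanuel is; unproved because for Liouville-type θ Diaz's zero estimate needs
a linear-independence measure for (ω_i θ^s) — T.H. was removed only at output 2 (Tijdeman);
Brownawell's Ch.16 route only weakens it.) [NesterenkoPhilippon2001, Diaz1989, Waldschmidt2004,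
Chudnovsky1984, arXiv:math/0312440]
#3 ExtremalGridsDilate (crux) — let x ∈ ℂⁿ be ℚ-independent, L = span x, and h an upper bound for
the degrees of number fields H with a line cH ⊆ L; if h < n and a balanced grid X, Y (d = l) inside
L attains 2d = n + h (equality in KneserCapacityBound), then some θ that is not a multiplier of L
has dim_ℚ(L ∩ θL) ≥ n − 2h. Progressions c·H[θ]_(<k) give n − h; the Bachoc–Serra–Zémor Sidon
3-space (1, x, y), x² + y² + 1 = 0, gives L = its square, n = 5, h = 1 and exactly n − 2 (linear
system O(2) on a pointless conic); trivial when n ≤ 5h (θ = ratio of two Y's gives (n+h)/2). The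
inverse/stability face of the card (its C1 in exact form). [deps: KneserCapacityBound] [difficulty:
L] (why it might fail: Critical pairs of ℚ-subspaces of ℂ are unclassified ("the complete picture
remains very much unclear", BachocSerraZemor2017 §1); a Sidon 4-space A over ℚ with dim A² = 7
(excluded only over finite fields, Thm 18) would give overlap 4 < 5.) [BachocSerraZemor2017,
HouLeungXiang2002, BachocSerraZemor2018Kneser, TaoVu2006]
#9 KneserCapacityBound (support) — for ℚ-independent x ∈ ℂⁿ, L = span x, h ≥ every degree [H:ℚ] of a
number field with a line cH ⊆ L, and any grid X (d ≥ 1), Y (l ≥ 1) inside L: d + l ≤ n + h. Proof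
(10 lines from linear Kneser, HouLeungXiang2002 Thm 1 as quoted in BachocSerraZemor2017 p.3;
separability is automatic in characteristic 0): U = span X, V = span Y, UV ⊆ L so dim UV ≤ n;
Stab(UV) is an intermediate field with Stab(UV)·w ⊆ UV ⊆ L for any w ≠ 0 in UV, so [Stab:ℚ] ≤ h;
Kneser gives d + l ≤ dim UV + [Stab:ℚ]. Corollaries: capacity ≤ (n+h)/4 ≤ n/2; card C1 (stability)
is the contrapositive. Formalisation cost = linear Kneser (e-transform induction, ~10 pp.), not in
Mathlib. [difficulty: L] [HouLeungXiang2002, BachocSerraZemor2018Kneser, BachocSerraZemor2017]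
#9 CapacityLeHalf (support) — any grid inside an n-dimensional span has 2dl ≤ n(d+l) (each of d, l
is ≤ n as soon as the other is positive: X ⊆ y⁻¹L is an independent family in an n-dimensional
space). The quotable half-of-Schanuel ceiling (card Theorem A(i)); with Conj. 2.3's t₂-clause it
reads "the class's conjectural completion certifies ≤ ⌊n/2⌋ + 1 on any tuple". [difficulty:
provable-now] [NesterenkoPhilippon2001, Chudnovsky1984]
#9 HalfOnlyOnNumberFieldLines (support) — if a grid with d = l = n ≥ 1 sits inside L = span x
(capacity exactly n/2) then L = c·K for a number field K of degree n (card Theorem A(ii)): each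
y_j·span X = L, so the ratios y_j/y_0 are n independent multipliers of L; the multiplier field has
degree ≤ n, hence = n and L is a line over it. Says route AlgIndepMethod's ladders are the unique
capacity maximisers. [difficulty: provable-now] [NesterenkoPhilippon2001, Diaz1989]
#9 ProgressionQuarter (support) — for transcendental θ and L = span(1, θ, …, θ^N), every grid with
d, l ≥ 1 inside L has d + l ≤ N + 2 (so capacity ≤ (N+2)/4: a QUARTER of Schanuel on power spans,
Chudnovsky's e, e^e, e^(e²), … counts; card Theorem C(a) for arbitrary, non-monomial grids). Proof:
normalise Y ∋ 1 so U ⊆ ℚ[θ]_≤N, V ⊂ ℚ(θ) ≅ ℚ(T); dim = number of distinct degrees; top degrees add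
to ≤ N, bottom degrees add to ≥ 0. False for θ algebraic of degree N+1 (then L is a field line),
hence the transcendence hypothesis. [difficulty: provable-now] [Chudnovsky1984,
BachocSerraZemor2017, TaoVu2006]
#9 NumberFieldBasisTH (support) — a ℚ-linearly independent family ω spanning a subring of ℂ (hence a
number field with basis ω) satisfies Waldschmidt's Technical Hypothesis (NesterenkoPhilippon2001
Ch.14 Def. 2.6, inlined verbatim from Literature.Barriers.Schanuel.TechnicalHypothesis): |Σ k_i ω_i|
≥ exp(−H^ε) for H ≥ H₀(ε) — indeed ≥ C·H^(−(h−1)) by the norm (Liouville) inequality. The discharge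
that makes Diaz unconditional on number-field lines. [difficulty: provable-now]
[NesterenkoPhilippon2001, BakerTNT1975]
#9 HalfSchanuelOnLinesOfDiaz (support) — HALF OF SCHANUEL ON EVERY NUMBER-FIELD LINE: assuming
Diaz's theorem in the printed t₂-form (hypothesis = the third conjunct of
Literature.Barriers.Schanuel.LargeTranscendenceDegree with gridField₂ and TechnicalHypothesis
unfolded verbatim, so that `LargeTranscendenceDegree_holds` discharges it by projection when it
lands), for every ℚ-basis ω of a number field of degree h ≥ 3 and every c ≠ 0: ⌈h/2⌉ ≤ trdeg ℚ(cω,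
e^(cω)). Proof: grid x = cω, y = ω (d = l = h, dl > d + l iff h ≥ 3), T.H. by NumberFieldBasisTH
(scaling by c is free), and ℚ(cω, ω, e^(cω_iω_j)) is algebraic over ℚ(cω, e^(cω)) because ω_iω_j ∈
span_ℚ ω. Card S4; c = log α is Diaz's corollary [(d+1)/2] behind AlgIndepMethod's ladder, here for
arbitrary c. [difficulty: M] [Diaz1989, NesterenkoPhilippon2001, Waldschmidt2004]

TWO-LAYER PLAN. Foreseen glued splits (none filed now): THFreeFloorOnProgressions ⇐ (output-2 range
h(a+1) ≤ 4 from Thm 2.9, T.H.-free) → (h = 1, a = 4: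
three of c, e^c, e^(cθ), …, e^(cθ⁸)-type, the first open size) → general; ExtremalGridsDilate ⇐ (k =
n/h ≤ 5, trivial) → (2-atoms over a number
field are Sidon of dimension ≤ 3, the BSZ programme over ℚ) → general; KneserCapacityBound ⇐ linear
Kneser (as a Literature theorem
Literature.Combinatorics.Additive.linearKneser, to be requested when a prover claims it) → the
10-line deduction.

KILL CRITERIA. KneserCapacityBound refuted (a grid with d + l > n + h(L)) closes the route outright
(`refuted:KneserCapacityBound`: the calibration thesis and
the card are wrong). ExtremalGridsDilate refuted by an explicit extremiser family ⇒ restate X2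
around that family (pivot, the classification
grows), not close. THFreeFloorOnProgressions refuted ⇒ Schanuel is refuted (hand the witness to
every route). HalfSchanuelOnLinesOfDiaz or
NumberFieldBasisTH refuted ⇒ a mis-inlined clause (repair by restate). Mooted if a Literature seat
vendors the whole calibration as a barrier
file first (then close superseded, items survive as its lemmas).

NOT DECOMPOSED YET. Theorem B of the card (Waldschmidt's several-parameter Conj. 2.4/2.5 have
horizon ≤ n/2 as well: needs a Lean rendering of those conjectures —
not attempted; the rank-projection count is recorded in the card); the exact extremal function g(L)
via the multiplier spectrum c ↦ dim(cL ∩ L)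
(card C(c); the Kemperman-type pair U = V = ℚ(√2) ⊕ ℚθ shows it is not a function of h(L) alone);
the power-tower corollary "⌈(N+2)/4⌉ of
e, e^e, …, e^(e^N)" (needs Mahler's transcendence measure of e as a second named fact — deliberately
not inlined); the triage table T1
(capacity of every staffed Schanuel tuple) — evidence, not an item; linear Kneser itself as a
Literature theorem (requested only when a
prover takes KneserCapacityBound).

CHEAPEST FALSIFIER. Two hand checks, both done by this planner and PASSED: (i) the
Bachoc–Serra–Zémor critical pair U = V = ⟨1, x, y⟩, x² + y² + 1 = 0
(BachocSerraZemor2017 §5) has d + l = 6 = n + h(L) with n = 5, h(L) = 1 — had it exceeded n + h the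
Kneser ceiling and the route were dead;
it also kills the NAIVE inverse statement "extremisers are geometric progressions", which is why X2
is stated through dilation overlap
(the conic gives exactly n − 2h); (ii) Chudnovsky's printed counts (Chudnovsky1984 p.22: 3 among
e,…,e^(e⁷); 4 among e,…,e^(e¹¹)) equal
⌈(n+1)/4⌉ = ⌈9/4⌉, ⌈13/4⌉. The next cheapest, for a refuter: search for a 4-dimensional ℚ-subspace A
⊂ ℚ̄ or ℚ(t, √(f(t))) with
dim A·A = 7 that is not a geometric progression (a Sidon 4-space with equality; BachocSerraZemor2017
Thm 18 forbids it over finite fields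
only) — its square would refute ExtremalGridsDilate.

NUMBERS. Class outputs on a d × l grid: unconditional t₂ ≥ 2 iff dl > d + l (Thm 2.9); ⌈dl/(d+l)⌉
under T.H. (Diaz, Thm 2.7); conjectural
⌊dl/(d+l)⌋ + 1 (Conj. 2.3); Schanuel: dl when the products are independent. Capacity: n/2 on
number-field lines (h = n), (n+1)/4 on power
spans (h = 1), (n+h)/4 in general (this route), n/(n+1) < 1 on structureless spans. Ladder: ⌈d/2⌉
known vs d − 1 wanted (AlgIndepMethod);
e-tower: 3 of 8, 4 of 12 (Chudnovsky1984 p.22). Items at open: 10 (2 cruxes, 1 target, 1 assembly, 6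
support).

DEFINITION REQUESTS. None filed: capacity, multiplier field and h(L) are inlined (∀ H :
IntermediateField ℚ ℂ, ∀ c ≠ 0, cH ⊆ L → finrank H ≤ h); T.H. and
Diaz's t₂-clause are inlined verbatim from Literature.Barriers.Schanuel.LargeTranscendenceDegree so
that the route imports Mathlib only
(no unproved named fact enters its import cone). If a prover takes KneserCapacityBound, a Literature
theorem `linearKneser` (HouLeungXiang2002
Thm 1) under Literature/Combinatorics/Additive is the natural request.

Novelty: Searches (2026-08-15): the card's and its novelty audit's page reads (NesterenkoPhilippon2001 Ch.14
pp.246–250, Chudnovsky1984 pp.22, 64,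
held); this planner: `lit search --source crossref "Kneser theorem field extensions"` (8;
BachocSerraZemor2018Kneser), `"generalization of an
addition theorem of Kneser Hou Leung Xiang"` (HouLeungXiang2002), `"analogue of Vosper's theorem for
extension fields"` (BachocSerraZemor2017,
READ arXiv:1501.00602 pp.3, 9–10: Thm 1 linear Kneser, Thm 3 linear Vosper for finite base field
only, §5 the ℚ-conic counterexample),
`lit search --source zbmath "Kneser theorem field extensions transcendence"` (0), `lit search
--hybrid "dimension of the product of two
subspaces of a field extension"` (local, nothing relevant), `lit frontier Schanuel --since 2020`
(Zilber–Pink/o-minimal only), `lit bridges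
Schanuel --cross any`, `lit galaxy search --star all` (galaxyd queued out), OpenAlex/arXiv 429;
Literature.Barriers.Schanuel.{LargeTranscendenceDegree,
LinearSubgroupMethodLimit}.lean read in full. Nearest prior art found: NesterenkoPhilippon2001 Ch.14
(per-grid theorems/conjectures),
Chudnovsky1984 p.22 ("half of Schanuel", tower counts), Roy1995 Thm 3.4 (a d + l ≤ 4r no-go by
ℚ-linear algebra on 3-dim log spans;
barrier LinearSubgroupMethodLimit), HouLeungXiang2002 / BachocSerraZemor2017 (linear Kneser/Vosper,
never pointed at transcendence grids),
card dilate-intersection-exponential-points (dilation overlaps). Delta: linear Kneser turns the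
class's print  [refs: 1501.00602, NesterenkoPhilippon2001, Chudnovsky1984, HouLeungXiang2002, BachocSerraZemor2017, Roy1995]

Barriers (technique_class: barrier-theorem large-trdeg additive-combinatorics): - technique_class: barrier-theorem large-trdeg additive-combinatorics
- Literature.Barriers.Schanuel.LargeTranscendenceDegree: not evaded — MEASURED: the route proves
that this barrier's technique class, including its conjectural target WaldschmidtConjecture_2_3,
certifies at most ⌊(n+h(L))/4⌋ + 1 ≤ ⌊n/2⌋ + 1 on any n-tuple, says where the maximum sits
(number-field lines; progressions/conics up to h), and files the class's own open step on those
tuples (crux 2 = its "because": the Technical Hypothesis) — proposed as a docstring addendum when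
the support items land.
- Literature.Barriers.Schanuel.LinearSubgroupMethodLimit: same genre (Roy1995 Thm 3.4 is a d + l ≤
4r count on a 3-dimensional span); consistent and complementary — that record concerns Waldschmidt's
linear subgroup theorem on spans of ℚ̄-independent logarithms, this one the exponential-grid
criteria on arbitrary spans; nothing to evade.
- Literature.Barriers.Schanuel.AlgebraicIndependenceOfLogarithms: strength barrier for positive
routes; this route claims no algebraic independence beyond Diaz's printed theorem (support
HalfSchanuelOnLinesOfDiaz is conditional on it) — n/a.
- Literature.Barriers.Schanuel.AxiomsDoNotForceSchanuel,
Literature.Barriers.Schanuel.SchanuelPropertyNotFirstOrder,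
Literature.Barriers.Schanuel.AxSchanuelFunctionalNotNumerical,
Literature.Barriers.Schanuel.NesterenkoModularScope,
Literature.Barriers.Schanuel.EFunctionValuesAtAlgebraicPoints,
Literature.Barriers.Schanuel.PeriodConjectureOver

History (route lifecycle, newest last):
- 2026-08-15T11:54:02Z · rev 1: restated Assembly (stmt-Schanuel-5818) — render repair: target GridCapacityCalibration named later decls (rank-0 rendered first => BLOCKED); drop it and let Assembly conclude in the explicit conjunctio (planner-plancard-Schanuel-Schanuel-grid-capac-7f2e3e00-0)
- 2026-08-15T11:54:02Z · rev 1: dropped GridCapacityCalibration — render repair: target GridCapacityCalibration named later decls (rank-0 rendered first => BLOCKED); drop it and let Assembly conclude in the explicit conjunctio (planner-plancard-Schanuel-Schanuel-grid-capac-7f2e3e00-0)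
- 2026-08-15T13:51:07Z · CLOSED retired — not-a-thesis: assembly does not conclude the sub-problem Statement (operator:999:1257524)

sub-problem: Schanuel · status: closed(retired) · opened planner-plancard-Schanuel-Schanuel-grid-capac-7f2e3e00-0 2026-08-15T11:42:47Z · rev 0 · ledger route-Schanuel-GridCapacity
GENERATED by the gate from the ledger (D-0016/17). Provers cite these decls: `theorem foo : Summit.Schanuel.Schanuel.Theses.GridCapacity.<Decl> := …` in Summits/Schanuel/Schanuel/Theorems/<Name>.lean.
-/

namespace Summit.Schanuel.Schanuel.Theses.GridCapacity

open scoped BigOperators Topology Manifold Classical MeasureTheory ProbabilityTheory Matrix InnerProductSpace ComplexConjugate ContinuousMap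
open Filter Set Function TopologicalSpace MeasureTheory

attribute [summit_statement] _root_.Schanuel

open Literature.Periods

/-- item stmt-Schanuel-5810 · crux · rank 2 · closed · moot by None · by planner
why it might fail: Cannot be false unless Schanuel is; unproved because for Liouville-type θ Diaz's zero estimate needs a linear-independence measure for (ω_i θ^s) — T.H. was removed only at output 2 (Tijdeman); Brownawell's Ch.16 route only weakens it.
sources: NesterenkoPhilippon2001, Diaz1989, Waldschmidt2004, Chudnovsky1984, arXiv:math/0312440
[crux] for a ℚ-basis ω of a number field of degree h (span closed under products), θ, c ≠ 0, a ≥ 1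
with h(a+1) ≥ 3 and the h(2a+1) numbers ω_i θ^s (s ≤ 2a) ℚ-linearly independent, put x = c·ω_i θ^s;
then ⌈h(a+1)/2⌉ ≤ trdeg ℚ(x, eˣ). This is Diaz's output on the extremal grid X = c·ω⊗θ^(≤a), Y =
ω⊗θ^(≤a) (d = l = h(a+1)) with NO Technical Hypothesis on θ (for the ω-part it is automatic, for c
it is free); the case a = 0 is the support item HalfSchanuelOnLinesOfDiaz. Implied by Schanuel (n =
h(2a+1)); known when the output is 2 (Thm 2.9, T.H.-free) and for θ satisfying (T.H.) (Thm 2.7).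
[difficulty: open-problem] -/
@[route_item "route-Schanuel-GridCapacity"]
def THFreeFloorOnProgressions : Prop :=
  ∀ (h a : ℕ) (ω : Fin h → ℂ) (θ c : ℂ), LinearIndependent ℚ ω → (∀ i j, ω i * ω j ∈ Submodule.span ℚ (Set.range ω)) → c ≠ 0 → 1 ≤ a → 3 ≤ h * (a + 1) → LinearIndependent ℚ (fun p : Fin h × Fin (2 * a + 1) => ω p.1 * θ ^ (p.2 : ℕ)) → (((h * (a + 1) + 1) / 2 : ℕ) : Cardinal) ≤ Algebra.trdeg ℚ ↥(IntermediateField.adjoin ℚ (Set.range (fun p : Fin h × Fin (2 * a + 1) => c * (ω p.1 * θ ^ (p.2 : ℕ))) ∪ Set.range (fun p : Fin h × Fin (2 * a + 1) => Complex.exp (c * (ω p.1 * θ ^ (p.2 : ℕ))))))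

/-- item stmt-Schanuel-5811 · crux · rank 3 · closed · moot by None · by planner
why it might fail: Critical pairs of ℚ-subspaces of ℂ are unclassified ("the complete picture remains very much unclear", BachocSerraZemor2017 §1); a Sidon 4-space A over ℚ with dim A² = 7 (excluded only over finite fields, Thm 18) would give overlap 4 < 5.
sources: BachocSerraZemor2017, HouLeungXiang2002, BachocSerraZemor2018Kneser, TaoVu2006
[crux] let x ∈ ℂⁿ be ℚ-independent, L = span x, and h an upper bound for the degrees of number
fields H with a line cH ⊆ L; if h < n and a balanced grid X, Y (d = l) inside L attains 2d = n + h
(equality in KneserCapacityBound), then some θ that is not a multiplier of L has dim_ℚ(L ∩ θL) ≥ n −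
2h. Progressions c·H[θ]_(<k) give n − h; the Bachoc–Serra–Zémor Sidon 3-space (1, x, y), x² + y² + 1
= 0, gives L = its square, n = 5, h = 1 and exactly n − 2 (linear system O(2) on a pointless conic);
trivial when n ≤ 5h (θ = ratio of two Y's gives (n+h)/2). The inverse/stability face of the card
(its C1 in exact form). [deps: KneserCapacityBound] [difficulty: L] -/
@[route_item "route-Schanuel-GridCapacity"]
def ExtremalGridsDilate : Prop :=
  ∀ (n : ℕ) (x : Fin n → ℂ), LinearIndependent ℚ x → ∀ (h : ℕ), (∀ (H : IntermediateField ℚ ℂ) (c : ℂ), c ≠ 0 → (∀ a ∈ H, c * a ∈ Submodule.span ℚ (Set.range x)) → Module.finrank ℚ H ≤ h) → h < n → ∀ (d : ℕ) (X Y : Fin d → ℂ), LinearIndependent ℚ X → LinearIndependent ℚ Y → (∀ i j, X i * Y j ∈ Submodule.span ℚ (Set.range x)) → 2 * d = n + h → ∃ θ : ℂ, (∃ v ∈ Submodule.span ℚ (Set.range x), θ * v ∉ Submodule.span ℚ (Set.range x)) ∧ n ≤ Module.finrank ℚ ↥(Submodule.span ℚ (Set.range x) ⊓ Submodule.map (LinearMap.mulLeft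 ℚ θ) (Submodule.span ℚ (Set.range x))) + 2 * h

/-- item stmt-Schanuel-5812 · support · rank 9 · closed · moot by None · by planner
sources: HouLeungXiang2002, BachocSerraZemor2018Kneser, BachocSerraZemor2017
[support] for ℚ-independent x ∈ ℂⁿ, L = span x, h ≥ every degree [H:ℚ] of a number field with a line
cH ⊆ L, and any grid X (d ≥ 1), Y (l ≥ 1) inside L: d + l ≤ n + h. Proof (10 lines from linear
Kneser, HouLeungXiang2002 Thm 1 as quoted in BachocSerraZemor2017 p.3; separability is automatic in
characteristic 0): U = span X, V = span Y, UV ⊆ L so dim UV ≤ n; Stab(UV) is an intermediate field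
with Stab(UV)·w ⊆ UV ⊆ L for any w ≠ 0 in UV, so [Stab:ℚ] ≤ h; Kneser gives d + l ≤ dim UV +
[Stab:ℚ]. Corollaries: capacity ≤ (n+h)/4 ≤ n/2; card C1 (stability) is the contrapositive.
Formalisation cost = linear Kneser (e-transform induction, ~10 pp.), not in Mathlib. [difficulty: L] -/
@[route_item "route-Schanuel-GridCapacity"]
def KneserCapacityBound : Prop :=
  ∀ (n : ℕ) (x : Fin n → ℂ), LinearIndependent ℚ x → ∀ (h : ℕ), (∀ (H : IntermediateField ℚ ℂ) (c : ℂ), c ≠ 0 → (∀ a ∈ H, c * a ∈ Submodule.span ℚ (Set.range x)) → Module.finrank ℚ H ≤ h) → ∀ (d l : ℕ) (X : Fin d → ℂ) (Y : Fin l → ℂ), LinearIndependent ℚ X → LinearIndependent ℚ Y → (∀ i j, X i * Y j ∈ Submodule.span ℚ (Set.range x)) → 0 < d → 0 < l → d + l ≤ n + h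

/-- item stmt-Schanuel-5813 · support · rank 9 · closed · moot by None · by planner
sources: NesterenkoPhilippon2001, Chudnovsky1984
[support] any grid inside an n-dimensional span has 2dl ≤ n(d+l) (each of d, l is ≤ n as soon as the
other is positive: X ⊆ y⁻¹L is an independent family in an n-dimensional space). The quotable
half-of-Schanuel ceiling (card Theorem A(i)); with Conj. 2.3's t₂-clause it reads "the class's
conjectural completion certifies ≤ ⌊n/2⌋ + 1 on any tuple". [difficulty: provable-now] -/
@[route_item "route-Schanuel-GridCapacity"]
def CapacityLeHalf : Prop :=
  ∀ (n : ℕ) (x : Fin n → ℂ), LinearIndependent ℚ x → ∀ (d l : ℕ) (X : Fin d → ℂ) (Y : Fin l → ℂ), LinearIndependent ℚ X → LinearIndependent ℚ Y → (∀ i j, X i * Y j ∈ Submodule.span ℚ (Set.range x)) → 2 * d * l ≤ n * (d + l)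

/-- item stmt-Schanuel-5814 · support · rank 9 · closed · moot by None · by planner
sources: NesterenkoPhilippon2001, Diaz1989
[support] if a grid with d = l = n ≥ 1 sits inside L = span x (capacity exactly n/2) then L = c·K
for a number field K of degree n (card Theorem A(ii)): each y_j·span X = L, so the ratios y_j/y_0
are n independent multipliers of L; the multiplier field has degree ≤ n, hence = n and L is a line
over it. Says route AlgIndepMethod's ladders are the unique capacity maximisers. [difficulty:
provable-now] -/
@[route_item "route-Schanuel-GridCapacity"]
def HalfOnlyOnNumberFieldLines : Prop :=
  ∀ (n : ℕ) (x : Fin n → ℂ), LinearIndependent ℚ x → 0 < n → ∀ (X Y : Fin n → ℂ), LinearIndependent ℚ X → LinearIndependent ℚ Y → (∀ i j, X i * Y j ∈ Submodule.span ℚ (Set.range x)) → ∃ (K : IntermediateField ℚ ℂ) (c : ℂ), Module.finrank ℚ K = n ∧ ∀ z : ℂ, z ∈ Submodule.span ℚ (Set.range x) ↔ ∃ k ∈ K, z = c * k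

/-- item stmt-Schanuel-5815 · support · rank 9 · closed · moot by None · by planner
sources: Chudnovsky1984, BachocSerraZemor2017, TaoVu2006
[support] for transcendental θ and L = span(1, θ, …, θ^N), every grid with d, l ≥ 1 inside L has d +
l ≤ N + 2 (so capacity ≤ (N+2)/4: a QUARTER of Schanuel on power spans, Chudnovsky's e, e^e, e^(e²),
… counts; card Theorem C(a) for arbitrary, non-monomial grids). Proof: normalise Y ∋ 1 so U ⊆
ℚ[θ]_≤N, V ⊂ ℚ(θ) ≅ ℚ(T); dim = number of distinct degrees; top degrees add to ≤ N, bottom degrees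
add to ≥ 0. False for θ algebraic of degree N+1 (then L is a field line), hence the transcendence
hypothesis. [difficulty: provable-now] -/
@[route_item "route-Schanuel-GridCapacity"]
def ProgressionQuarter : Prop :=
  ∀ (N : ℕ) (θ : ℂ), Transcendental ℚ θ → ∀ (d l : ℕ) (X : Fin d → ℂ) (Y : Fin l → ℂ), LinearIndependent ℚ X → LinearIndependent ℚ Y → (∀ i j, X i * Y j ∈ Submodule.span ℚ (Set.range fun s : Fin (N + 1) => θ ^ (s : ℕ))) → 0 < d → 0 < l → d + l ≤ N + 2

/-- item stmt-Schanuel-5816 · support · rank 9 · closed · moot by None · by planner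
sources: NesterenkoPhilippon2001, BakerTNT1975
[support] a ℚ-linearly independent family ω spanning a subring of ℂ (hence a number field with basis
ω) satisfies Waldschmidt's Technical Hypothesis (NesterenkoPhilippon2001 Ch.14 Def. 2.6, inlined
verbatim from Literature.Barriers.Schanuel.TechnicalHypothesis): |Σ k_i ω_i| ≥ exp(−H^ε) for H ≥
H₀(ε) — indeed ≥ C·H^(−(h−1)) by the norm (Liouville) inequality. The discharge that makes Diaz
unconditional on number-field lines. [difficulty: provable-now] -/
@[route_item "route-Schanuel-GridCapacity"]
def NumberFieldBasisTH : Prop :=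
  ∀ (h : ℕ) (ω : Fin h → ℂ), LinearIndependent ℚ ω → (∀ i j, ω i * ω j ∈ Submodule.span ℚ (Set.range ω)) → ∀ ε : ℝ, 0 < ε → ∃ H₀ : ℝ, 0 < H₀ ∧ ∀ H : ℝ, H₀ ≤ H → ∀ k : Fin h → ℤ, k ≠ 0 → (∀ i, |(k i : ℝ)| ≤ H) → Real.exp (-(H ^ ε)) ≤ ‖∑ i, (k i : ℂ) * ω i‖

/-- item stmt-Schanuel-5817 · support · rank 9 · closed · moot by None · by planner
sources: Diaz1989, NesterenkoPhilippon2001, Waldschmidt2004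
[support] HALF OF SCHANUEL ON EVERY NUMBER-FIELD LINE: assuming Diaz's theorem in the printed
t₂-form (hypothesis = the third conjunct of Literature.Barriers.Schanuel.LargeTranscendenceDegree
with gridField₂ and TechnicalHypothesis unfolded verbatim, so that `LargeTranscendenceDegree_holds`
discharges it by projection when it lands), for every ℚ-basis ω of a number field of degree h ≥ 3
and every c ≠ 0: ⌈h/2⌉ ≤ trdeg ℚ(cω, e^(cω)). Proof: grid x = cω, y = ω (d = l = h, dl > d + l iff h
≥ 3), T.H. by NumberFieldBasisTH (scaling by c is free), and ℚ(cω, ω, e^(cω_iω_j)) is algebraic over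
ℚ(cω, e^(cω)) because ω_iω_j ∈ span_ℚ ω. Card S4; c = log α is Diaz's corollary [(d+1)/2] behind
AlgIndepMethod's ladder, here for arbitrary c. [difficulty: M] -/
@[route_item "route-Schanuel-GridCapacity"]
def HalfSchanuelOnLinesOfDiaz : Prop :=
  (∀ (d l : ℕ) (x : Fin d → ℂ) (y : Fin l → ℂ), LinearIndependent ℚ x → (∀ ε : ℝ, 0 < ε → ∃ H₀ : ℝ, 0 < H₀ ∧ ∀ H : ℝ, H₀ ≤ H → ∀ k : Fin d → ℤ, k ≠ 0 → (∀ i, |(k i : ℝ)| ≤ H) → Real.exp (-(H ^ ε)) ≤ ‖∑ i, (k i : ℂ) * x i‖) → LinearIndependent ℚ y → (∀ ε : ℝ, 0 < ε → ∃ H₀ : ℝ, 0 < H₀ ∧ ∀ H : ℝ, H₀ ≤ H → ∀ k : Fin l → ℤ, k ≠ 0 → (∀ i, |(k i : ℝ)| ≤ H) → Real.exp (-(H ^ ε)) ≤ ‖∑ i, (k i : ℂ) * y i‖) → l + d < d * l → ((⌈((d * l : ℕ) : ℚ) / ((l + d : ℕ) : ℚ)⌉₊ : ℕ) : Cardinal)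 ≤ Algebra.trdeg ℚ ↥(IntermediateField.adjoin ℚ (Set.range x ∪ Set.range y ∪ Set.range (fun p : Fin d × Fin l => Complex.exp (x p.1 * y p.2))))) → ∀ (h : ℕ) (ω : Fin h → ℂ) (c : ℂ), LinearIndependent ℚ ω → (∀ i j, ω i * ω j ∈ Submodule.span ℚ (Set.range ω)) → c ≠ 0 → 3 ≤ h → (((h + 1) / 2 : ℕ) : Cardinal) ≤ Algebra.trdeg ℚ ↥(IntermediateField.adjoin ℚ (Set.range (fun i => c * ω i) ∪ Set.range (fun i => Complex.exp (c * ω i))))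

-- earlier Assembly (stmt-Schanuel-5818, replaced 2026-08-15T11:54:02Z -> stmt-Schanuel-6834): retired by None — KneserCapacityBound → ExtremalGridsDilate → THFreeFloorOnProgressions → GridCapacityCalibration
/-- item stmt-Schanuel-6834 · assembly · rank 1 · closed · moot by None · by planner
sources: HouLeungXiang2002, NesterenkoPhilippon2001
[assembly] KneserCapacityBound → ExtremalGridsDilate → THFreeFloorOnProgressions → X, where X = the
conjunction of the three (the calibration package: ceiling ∧ inverse structure ∧ T.H.-free floor).
Pure logic (fun a b c => ⟨a, b, c⟩, checked in the planner Sketch.lean). NOT an implication to the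
summit — barrier/calibration route by declaration. The separate target decl GridCapacityCalibration
(same conjunction by name) was dropped at rev 1 because the gate renders rank-0 items before the
decls they name; X now lives as the conclusion of this item. -/
@[route_item "route-Schanuel-GridCapacity"]
def Assembly : Prop :=
  KneserCapacityBound → ExtremalGridsDilate → THFreeFloorOnProgressions → (KneserCapacityBound ∧ ExtremalGridsDilate ∧ THFreeFloorOnProgressions)

end Summit.Schanuel.Schanuel.Theses.GridCapacity
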